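import Summits.QuantumFields.YangMills.Theorems.ColdStartUniversalityLatticeLangevinRiemannLipschitzContraction
import HarnessLib

/-!
# Two LOCALISATIONS of the seat's `ρ_L`-Lipschitz ⇄ carré-du-champ dictionary for the `SU(2)` lattice Langevin dynamics:
# `Γ^A(f) ≤ σ²` on a `ρ_L`-ball ⇒ Lipschitz between its centre and boundary point; Lipschitz at one point on a small ball ⇒ `Γ^A(f) ≤ 2L²` there

Seat `ym-line-csu-p1` (g42), route `ColdStartUniversality` of `Summits/QuantumFields/YangMills`, helper file G63a (`--supports stmt-QuantumFields-24809`).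
G42 (`abs_sub_le_sqrt_carre_mul_sqrt_torusRiemannDistSq`) and G44 (`carre_le_two_mul_sq_of_riemannLipschitz`) relate a GLOBAL bound on the coordinate
carré du champ `Γ^A(f) = 2|∇(f∘coords)|²_ρ` to a GLOBAL `ρ_L`-Lipschitz constant.  Kuwada's duality for the `W₂` form of Shen–Zhu–Zhu's Theorem 4.2
(sequel files) needs both directions with LOCAL data — the Hopf–Lax functions have only pointwise slopes.  Same proofs, localised hypotheses:

* ★★ `abs_sub_le_of_carre_le_on_ball` — `Γ^A(f)(y) ≤ σ²` for all `y` with `ρ_L(Q,y) ≤ ρ_L(Q,Q')` ⇒ `|f(coords Q') − f(coords Q)| ≤ √(σ²/2)·ρ_L(Q,Q')`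
  (the minimal product geodesic from `Q` to `Q'` stays in that ball);
* ★★ `carre_le_two_mul_sq_of_local_riemannLipschitz` — `|f(coords Q') − f(coords V)| ≤ L_f·ρ_L(V,Q')` for `ρ_L(V,Q') < δ` ⇒ `Γ^A(f)(V) ≤ 2L_f²`
  (the gradient flow through `V` is tested only for small times).

THEOREMS ONLY, no definition, no sorry.  HONEST FRAMING: fixed cut-off, `|β'| < 1/12`; "uniform" = in `L`; nothing `K`-uniform along the route's
scaling; `UniformColdStartMixing` (24809, ASIDE) is not restated; no crux, rung or summit statement is proved; the Yang–Mills mass gap is NOT proved.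
-/

set_option autoImplicit false

noncomputable section

namespace Summit.QuantumFields.YangMills.Theorems.ColdStartUniversality

open MeasureTheory ProbabilityTheory Matrix Complex Finset Filter Topology Set Metric
open scoped ComplexConjugate BigOperators Real NNReal Convolution
open Literature.MathematicalPhysics.QuantumFieldTheory
open Literature.MathematicalPhysics.QuantumLattice (fundamentalRep fundamentalLatticeRep continuous_fundamentalRep fundamentalRep_apply fundamentalLatticeRep_N)

variable {L : ℕ} [NeZero L]

/-! ## §1. G42 localised: from `Γ^A ≤ σ²` on a ball to a Lipschitz bound between its centre and a point -/

section Local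

open scoped Matrix.Norms.Operator

/-- ★★ **Localised G42.**  Let `f` be differentiable with `Γ^A(f)(y) ≤ σ²` for every `y` with `ρ_L(Q,y) ≤ ρ_L(Q,Q')`.  Then
`|f(coords Q') − f(coords Q)| ≤ √(σ²/2)·ρ_L(Q,Q')` (mean value inequality along the minimal product geodesic, which stays in that ball).
[cite: BakryGentilLedoux2014, §1.11 and (3.2.4)] -/
theorem abs_sub_le_of_carre_le_on_ball (L : ℕ) [NeZero L] (Q Q' : GaugeConfig 3 L (Matrix.specialUnitaryGroup (Fin 2) ℂ)) (β' : ℝ)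
    {f : (Edge 3 L × Fin 2 × Fin 2 × Bool → ℝ) → ℝ} (hf : Differentiable ℝ f) {σ2 : ℝ} :
    let coords : GaugeConfig 3 L (Matrix.specialUnitaryGroup (Fin 2) ℂ) → (Edge 3 L × Fin 2 × Fin 2 × Bool → ℝ) :=
      fun V q => (fun z : ℂ => if q.2.2.2 then z.im else z.re)
        ((fundamentalRep (Fin 2) (V q.1) : Matrix (Fin 2) (Fin 2) ℂ) q.2.1 q.2.2.1)
    let A : GaugeConfig 3 L (Matrix.specialUnitaryGroup (Fin 2) ℂ) → (Edge 3 L × Fin 2 × Fin 2 × Bool) →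
        (Edge 3 L × Fin 2 × Fin 2 × Bool) → ℝ := fun V i j =>
      ∑ n : Edge 3 L × NoiseIdx 2,
        (if n.1 = i.1 then (fun z : ℂ => if i.2.2.2 then z.im else z.re)
          ((latticeLangevinDynamics (fundamentalLatticeRep 2) β').noise
            (matrixConfig (fundamentalRep (Fin 2)) V) i.1 n.2 i.2.1 i.2.2.1) else 0) *
        (if n.1 = j.1 then (fun z : ℂ => if j.2.2.2 then z.im else z.re)
          ((latticeLangevinDynamics (fundamentalLatticeRep 2) β').noise
            (matrixConfig (fundamentalRep (Fin 2)) V) j.1 n.2 j.2.1 j.2.2.1) else 0)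
    (∀ y, torusRiemannDistSq (fundamentalLatticeRep 2) Q y ≤ torusRiemannDistSq (fundamentalLatticeRep 2) Q Q' →
      (∑ i : Edge 3 L × Fin 2 × Fin 2 × Bool, ∑ j : Edge 3 L × Fin 2 × Fin 2 × Bool,
        fderiv ℝ f (coords y) (Pi.single i 1) * fderiv ℝ f (coords y) (Pi.single j 1) * A y i j) ≤ σ2) →
      |f (coords Q') - f (coords Q)| ≤ Real.sqrt (σ2 / 2) * Real.sqrt (torusRiemannDistSq (fundamentalLatticeRep 2) Q Q') := by
  intro coords A hΓ
  classical
  -- minimal logarithms link by link (G40)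
  have hlog : ∀ e : Edge 3 L, ∃ X : Matrix (Fin (fundamentalLatticeRep 2).N) (Fin (fundamentalLatticeRep 2).N) ℂ, X ∈ (fundamentalLatticeRep 2).lieAlg ∧
      NormedSpace.exp X * (fundamentalLatticeRep 2).ρ (Q e) = (fundamentalLatticeRep 2).ρ (Q' e) ∧
      Real.sqrt (hsForm (fundamentalLatticeRep 2).N X X) = (fundamentalLatticeRep 2).riemannDist (Q e) (Q' e) := fun e =>
    exists_mem_lieAlg_exp_mul_eq_sqrt_hsForm_eq_riemannDist (Q e) (Q' e)
  choose X hXmem hXexp hXnorm using hlog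
  have hXh : ∀ e, (X e)ᴴ = -(X e) := fun e => by
    rw [← Matrix.star_eq_conjTranspose]; exact (fundamentalLatticeRep 2).star_eq_neg_of_mem_lieAlg (hXmem e)
  have hX0 : ∀ e, (X e).trace = 0 := fun e => trace_eq_zero_of_mem_lieAlg_two (hXmem e)
  have hsq : ∀ e, hsForm (fundamentalLatticeRep 2).N (X e) (X e) = (fundamentalLatticeRep 2).riemannDist (Q e) (Q' e) ^ 2 := fun e => by
    rw [← hXnorm e, Real.sq_sqrt (hsForm_self_nonneg _)]
  have hdist : ∑ e : Edge 3 L, hsForm (fundamentalLatticeRep 2).N (X e) (X e) = torusRiemannDistSq (fundamentalLatticeRep 2) Q Q' := by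
    unfold torusRiemannDistSq; exact Finset.sum_congr rfl fun e _ => hsq e
  -- the product geodesic `γ_s = (e^(sX_e) Q_e)_e`
  set γ : ℝ → GaugeConfig 3 L (Matrix.specialUnitaryGroup (Fin 2) ℂ) := fun s e =>
    SUNBakryEmery.expSU (N := 2) (Y := Matrix.of fun i j : Fin 2 => X e i j) (hXh e) (hX0 e) s * Q e with hγ
  have hγcoe : ∀ s e, (fundamentalLatticeRep 2).ρ (γ s e) = NormedSpace.exp (s • X e) * (fundamentalLatticeRep 2).ρ (Q e) := fun s e => rfl
  have hγ0 : γ 0 = Q := by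
    funext e
    apply Subtype.ext
    change NormedSpace.exp ((0 : ℝ) • X e) * (fundamentalLatticeRep 2).ρ (Q e) = (fundamentalLatticeRep 2).ρ (Q e)
    rw [zero_smul, NormedSpace.exp_zero, Matrix.one_mul]
  have hγ1 : γ 1 = Q' := by
    funext e
    apply Subtype.ext
    change NormedSpace.exp ((1 : ℝ) • X e) * (fundamentalLatticeRep 2).ρ (Q e) = (fundamentalLatticeRep 2).ρ (Q' e)
    rw [one_smul, hXexp e]
  -- the coordinate map `CO` of matrix configurations and the path in coordinates
  set COf : (Edge 3 L → Matrix (Fin (fundamentalLatticeRep 2).N) (Fin (fundamentalLatticeRep 2).N) ℂ) → (Edge 3 L × Fin 2 × Fin 2 × Bool → ℝ) := fun Mc q =>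
    (fun z : ℂ => if q.2.2.2 then z.im else z.re) (Mc q.1 q.2.1 q.2.2.1) with hCOf
  have hCOadd : ∀ M₁ M₂, COf (M₁ + M₂) = COf M₁ + COf M₂ := by
    intro M₁ M₂; funext q; obtain ⟨e, a, b, flag⟩ := q
    cases flag
    · change ((M₁ e a b) + (M₂ e a b)).re = (M₁ e a b).re + (M₂ e a b).re
      exact Complex.add_re _ _
    · change ((M₁ e a b) + (M₂ e a b)).im = (M₁ e a b).im + (M₂ e a b).im
      exact Complex.add_im _ _
  have hCOsmul : ∀ (t : ℝ) M₁, COf (t • M₁) = t • COf M₁ := by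
    intro t M₁; funext q; obtain ⟨e, a, b, flag⟩ := q
    cases flag
    · change (t • (M₁ e a b)).re = t * (M₁ e a b).re
      rw [Complex.smul_re, smul_eq_mul]
    · change (t • (M₁ e a b)).im = t * (M₁ e a b).im
      rw [Complex.smul_im, smul_eq_mul]
  let COl : (Edge 3 L → Matrix (Fin (fundamentalLatticeRep 2).N) (Fin (fundamentalLatticeRep 2).N) ℂ) →ₗ[ℝ] (Edge 3 L × Fin 2 × Fin 2 × Bool → ℝ) := { toFun := COf, map_add' := hCOadd, map_smul' := hCOsmul }
  let CO : (Edge 3 L → Matrix (Fin (fundamentalLatticeRep 2).N) (Fin (fundamentalLatticeRep 2).N) ℂ) →L[ℝ] (Edge 3 L × Fin 2 × Fin 2 × Bool → ℝ) := LinearMap.toContinuousLinearMap COl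
  have hCO : ∀ Mc, CO Mc = COf Mc := fun _ => rfl
  set P : ℝ → (Edge 3 L → Matrix (Fin (fundamentalLatticeRep 2).N) (Fin (fundamentalLatticeRep 2).N) ℂ) := fun s e => NormedSpace.exp (s • X e) * (fundamentalLatticeRep 2).ρ (Q e) with hP
  set P' : ℝ → (Edge 3 L → Matrix (Fin (fundamentalLatticeRep 2).N) (Fin (fundamentalLatticeRep 2).N) ℂ) := fun s e => X e * NormedSpace.exp (s • X e) * (fundamentalLatticeRep 2).ρ (Q e) with hP'
  have hcoP : ∀ s, coords (γ s) = CO (P s) := fun s => by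
    rw [hCO]; funext q; rfl
  have hPd : ∀ s, HasDerivAt P (P' s) s := fun s =>
    hasDerivAt_pi.2 fun e => (hasDerivAt_exp_smul_const' (𝕂 := ℝ) (X e) s).mul_const _
  -- the derivative of `s ↦ f(coords γ_s)` and its bound
  have hφd : ∀ s, HasDerivAt (fun s => f (coords (γ s))) (fderiv ℝ f (CO (P s)) (CO (P' s))) s := by
    intro s
    have h := (hf (CO (P s))).hasFDerivAt.comp_hasDerivAt s (CO.hasFDerivAt.comp_hasDerivAt s (hPd s))
    have heq : (fun s => f (coords (γ s))) = f ∘ (⇑CO) ∘ P := by funext s; simp only [Function.comp_apply, hcoP]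
    rw [heq]; exact h
  have hbound : ∀ s ∈ Set.Icc (0 : ℝ) 1, |fderiv ℝ f (CO (P s)) (CO (P' s))| ≤ Real.sqrt (σ2 / 2) * Real.sqrt (torusRiemannDistSq (fundamentalLatticeRep 2) Q Q') := by
    intro s hs01
    -- `γ_s` stays in the ball: `ρ_L(Q, γ_s)² ≤ s²·ρ_L(Q,Q')² ≤ ρ_L(Q,Q')²`
    have hball : torusRiemannDistSq (fundamentalLatticeRep 2) Q (γ s) ≤ torusRiemannDistSq (fundamentalLatticeRep 2) Q Q' := by
      have h1 := torusRiemannDistSq_prodFlow_le Q X hXmem hXh hX0 s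
      rw [hdist] at h1
      have hs2 : s ^ 2 ≤ 1 := by
        have := hs01.1; have := hs01.2; nlinarith
      have h0 : 0 ≤ torusRiemannDistSq (fundamentalLatticeRep 2) Q Q' := by
        unfold torusRiemannDistSq; exact Finset.sum_nonneg fun _ _ => sq_nonneg _
      calc torusRiemannDistSq (fundamentalLatticeRep 2) Q (γ s) ≤ s ^ 2 * torusRiemannDistSq (fundamentalLatticeRep 2) Q Q' := h1
        _ ≤ 1 * torusRiemannDistSq (fundamentalLatticeRep 2) Q Q' := mul_le_mul_of_nonneg_right hs2 h0
        _ = torusRiemannDistSq (fundamentalLatticeRep 2) Q Q' := one_mul _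
    -- the velocity is the frame-expanded vector of G42 §1 at `V = γ_s`
    have hv : CO (P' s) = fun q : Edge 3 L × Fin 2 × Fin 2 × Bool => (fun z : ℂ => if q.2.2.2 then z.im else z.re)
        ((X q.1 * (fundamentalLatticeRep 2).ρ (γ s q.1)) q.2.1 q.2.2.1) := by
      rw [hCO]; funext q
      simp only [hCOf, hP', hγcoe, Matrix.mul_assoc]
    have hCS := frame_cauchySchwarz_two (L := L) (γ s) X hXmem (fderiv ℝ f (CO (P s)))
    have hΓs : (∑ i : Edge 3 L × Fin 2 × Fin 2 × Bool, ∑ j : Edge 3 L × Fin 2 × Fin 2 × Bool,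
        fderiv ℝ f (coords (γ s)) (Pi.single i 1) * fderiv ℝ f (coords (γ s)) (Pi.single j 1) * A (γ s) i j) =
        ∑ n : Edge 3 L × NoiseIdx (fundamentalLatticeRep 2).N, (fderiv ℝ f (coords (γ s)) (fun q : Edge 3 L × Fin (fundamentalLatticeRep 2).N × Fin (fundamentalLatticeRep 2).N × Bool =>
          if n.1 = q.1 then (fun z : ℂ => if q.2.2.2 then z.im else z.re) (((Real.sqrt 2 : ℂ) • ((fundamentalLatticeRep 2).lieProj (noiseDir n.2) *
            (fundamentalLatticeRep 2).ρ (γ s q.1))) q.2.1 q.2.2.1) else 0)) ^ 2 := carre_eq_sum_sq_frame_two β' f (γ s)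
    have hle : (∑ n : Edge 3 L × NoiseIdx (fundamentalLatticeRep 2).N, (fderiv ℝ f (CO (P s)) (fun q : Edge 3 L × Fin (fundamentalLatticeRep 2).N × Fin (fundamentalLatticeRep 2).N × Bool =>
          if n.1 = q.1 then (fun z : ℂ => if q.2.2.2 then z.im else z.re) (((Real.sqrt 2 : ℂ) • ((fundamentalLatticeRep 2).lieProj (noiseDir n.2) *
            (fundamentalLatticeRep 2).ρ (γ s q.1))) q.2.1 q.2.2.1) else 0)) ^ 2) ≤ σ2 := by
      rw [← hcoP, ← hΓs]; exact hΓ (γ s) hball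
    have h0 : 0 ≤ ∑ e : Edge 3 L, hsForm (fundamentalLatticeRep 2).N (X e) (X e) := Finset.sum_nonneg fun e _ => hsForm_self_nonneg _
    have hsq2 : (fderiv ℝ f (CO (P s)) (CO (P' s))) ^ 2 ≤ (torusRiemannDistSq (fundamentalLatticeRep 2) Q Q') / 2 * σ2 := by
      rw [hv, ← hdist]
      exact hCS.trans (mul_le_mul_of_nonneg_left hle (by positivity))
    have hσ0 : 0 ≤ σ2 := le_trans (Finset.sum_nonneg fun n _ => sq_nonneg _) hle
    calc |fderiv ℝ f (CO (P s)) (CO (P' s))| = Real.sqrt ((fderiv ℝ f (CO (P s)) (CO (P' s))) ^ 2) := (Real.sqrt_sq_eq_abs _).symm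
      _ ≤ Real.sqrt ((torusRiemannDistSq (fundamentalLatticeRep 2) Q Q') / 2 * σ2) := Real.sqrt_le_sqrt hsq2
      _ = Real.sqrt (σ2 / 2) * Real.sqrt (torusRiemannDistSq (fundamentalLatticeRep 2) Q Q') := by
          rw [← Real.sqrt_mul (by positivity : (0:ℝ) ≤ σ2 / 2)]
          congr 1; ring
  -- mean value inequality on `[0, 1]`
  have hMV := norm_image_sub_le_of_norm_deriv_le_segment_01' (f := fun s => f (coords (γ s)))
    (f' := fun s => fderiv ℝ f (CO (P s)) (CO (P' s))) (fun s _ => (hφd s).hasDerivWithinAt)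
    (fun s hs => by rw [Real.norm_eq_abs]; exact hbound s (Set.Ico_subset_Icc_self hs))
  rw [Real.norm_eq_abs] at hMV
  simpa only [hγ0, hγ1] using hMV


/-! ## §2. G44 localised: a Lipschitz bound at one point on a small ball bounds the carré du champ there -/

/-- ★★ **Localised G44.**  If `f` is differentiable and `|f(coords Q') − f(coords V)| ≤ L_f·ρ_L(V,Q')` for all `Q'` with `ρ_L(V,Q') < δ` (some `δ > 0`),
then `Γ^A(f)(V) ≤ 2L_f²` (test along the flow generated by the gradient at `V`, for small times). [cite: BakryGentilLedoux2014, §1.11 and (3.2.4)] -/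
theorem carre_le_two_mul_sq_of_local_riemannLipschitz (V : GaugeConfig 3 L (Matrix.specialUnitaryGroup (Fin 2) ℂ)) (β' : ℝ)
    {f : (Edge 3 L × Fin 2 × Fin 2 × Bool → ℝ) → ℝ} (hf : Differentiable ℝ f)
    {Lf : ℝ} (hLf : 0 ≤ Lf) :
    let coords : GaugeConfig 3 L (Matrix.specialUnitaryGroup (Fin 2) ℂ) → (Edge 3 L × Fin 2 × Fin 2 × Bool → ℝ) :=
      fun V q => (fun z : ℂ => if q.2.2.2 then z.im else z.re)
        ((fundamentalRep (Fin 2) (V q.1) : Matrix (Fin 2) (Fin 2) ℂ) q.2.1 q.2.2.1)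
    let A : GaugeConfig 3 L (Matrix.specialUnitaryGroup (Fin 2) ℂ) → (Edge 3 L × Fin 2 × Fin 2 × Bool) →
        (Edge 3 L × Fin 2 × Fin 2 × Bool) → ℝ := fun V i j =>
      ∑ n : Edge 3 L × NoiseIdx 2,
        (if n.1 = i.1 then (fun z : ℂ => if i.2.2.2 then z.im else z.re)
          ((latticeLangevinDynamics (fundamentalLatticeRep 2) β').noise
            (matrixConfig (fundamentalRep (Fin 2)) V) i.1 n.2 i.2.1 i.2.2.1) else 0) *
        (if n.1 = j.1 then (fun z : ℂ => if j.2.2.2 then z.im else z.re)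
          ((latticeLangevinDynamics (fundamentalLatticeRep 2) β').noise
            (matrixConfig (fundamentalRep (Fin 2)) V) j.1 n.2 j.2.1 j.2.2.1) else 0)
    (∃ δ > 0, ∀ Q' : GaugeConfig 3 L (Matrix.specialUnitaryGroup (Fin 2) ℂ), Real.sqrt (torusRiemannDistSq (fundamentalLatticeRep 2) V Q') < δ →
      |f (coords Q') - f (coords V)| ≤ Lf * Real.sqrt (torusRiemannDistSq (fundamentalLatticeRep 2) V Q')) →
    (∑ i : Edge 3 L × Fin 2 × Fin 2 × Bool, ∑ j : Edge 3 L × Fin 2 × Fin 2 × Bool,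
        fderiv ℝ f (coords V) (Pi.single i 1) * fderiv ℝ f (coords V) (Pi.single j 1) * A V i j) ≤ 2 * Lf ^ 2 := by
  intro coords A hlip
  obtain ⟨δ, hδ, hlip⟩ := hlip
  classical
  -- the frame derivatives `D_n = Df(coords V)[σ_n(V)]` and the carré du champ `G = Σ D_n²`
  set D : Edge 3 L × NoiseIdx (fundamentalLatticeRep 2).N → ℝ := fun n => fderiv ℝ f (coords V)
    (fun q : Edge 3 L × Fin (fundamentalLatticeRep 2).N × Fin (fundamentalLatticeRep 2).N × Bool =>
      if n.1 = q.1 then (fun z : ℂ => if q.2.2.2 then z.im else z.re) (((Real.sqrt 2 : ℂ) • ((fundamentalLatticeRep 2).lieProj (noiseDir n.2) *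
        (fundamentalLatticeRep 2).ρ (V q.1))) q.2.1 q.2.2.1) else 0) with hD
  have hG : (∑ i : Edge 3 L × Fin 2 × Fin 2 × Bool, ∑ j : Edge 3 L × Fin 2 × Fin 2 × Bool,
      fderiv ℝ f (coords V) (Pi.single i 1) * fderiv ℝ f (coords V) (Pi.single j 1) * A V i j) = ∑ n, D n ^ 2 :=
    carre_eq_sum_sq_frame_two β' f V
  rw [hG]
  set G : ℝ := ∑ n, D n ^ 2 with hGdef
  have hG0 : 0 ≤ G := Finset.sum_nonneg fun n _ => sq_nonneg _
  -- the gradient direction `X_e = Σ_ν √2 D_(e,ν) 𝐩(E_ν) ∈ 𝔰𝔲(2)`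
  set X : Edge 3 L → Matrix (Fin (fundamentalLatticeRep 2).N) (Fin (fundamentalLatticeRep 2).N) ℂ := fun e =>
    ∑ m : NoiseIdx (fundamentalLatticeRep 2).N, (D (e, m) * Real.sqrt 2) • (fundamentalLatticeRep 2).lieProj (noiseDir m) with hXdef
  have hXmem : ∀ e, X e ∈ (fundamentalLatticeRep 2).lieAlg := fun e =>
    Submodule.sum_mem _ fun m _ => (fundamentalLatticeRep 2).lieAlg.smul_mem _ ((fundamentalLatticeRep 2).lieProj_mem _)
  have hXh : ∀ e, (X e)ᴴ = -(X e) := fun e => by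
    rw [← Matrix.star_eq_conjTranspose]; exact (fundamentalLatticeRep 2).star_eq_neg_of_mem_lieAlg (hXmem e)
  have hX0 : ∀ e, (X e).trace = 0 := fun e => trace_eq_zero_of_mem_lieAlg_two (hXmem e)
  have hXproj : ∀ e, X e = (fundamentalLatticeRep 2).lieProj (∑ m : NoiseIdx (fundamentalLatticeRep 2).N, (D (e, m) * Real.sqrt 2) • noiseDir m) := fun e => by
    rw [map_sum]; simp_rw [map_smul]; rfl
  have hXnorm : ∑ e : Edge 3 L, hsForm (fundamentalLatticeRep 2).N (X e) (X e) ≤ 2 * G := by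
    calc ∑ e : Edge 3 L, hsForm (fundamentalLatticeRep 2).N (X e) (X e)
        ≤ ∑ e : Edge 3 L, ∑ m : NoiseIdx (fundamentalLatticeRep 2).N, (D (e, m) * Real.sqrt 2) ^ 2 :=
          Finset.sum_le_sum fun e _ => by rw [hXproj, ← hsForm_sum_smul_noiseDir_self]; exact hsForm_lieProj_self_le _ _
      _ = 2 * G := by
          rw [hGdef]
          conv_rhs => rw [Fintype.sum_prod_type, Finset.mul_sum]
          refine Finset.sum_congr rfl fun e _ => ?_
          rw [Finset.mul_sum]
          exact Finset.sum_congr rfl fun m _ => by rw [mul_pow, Real.sq_sqrt (by norm_num : (0:ℝ) ≤ 2)]; ring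
  -- the flow along `X` and the derivative of `f ∘ coords` along it at `s = 0`
  set γ : ℝ → GaugeConfig 3 L (Matrix.specialUnitaryGroup (Fin 2) ℂ) := fun s e =>
    SUNBakryEmery.expSU (N := 2) (Y := Matrix.of fun i j : Fin 2 => X e i j) (hXh e) (hX0 e) s * V e with hγ
  have hγ0 : γ 0 = V := by
    funext e; apply Subtype.ext
    change NormedSpace.exp ((0 : ℝ) • X e) * (fundamentalLatticeRep 2).ρ (V e) = (fundamentalLatticeRep 2).ρ (V e)
    rw [zero_smul, NormedSpace.exp_zero, Matrix.one_mul]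
  have hder : HasDerivAt (fun s => f (coords (γ s))) (fderiv ℝ f (coords (γ 0))
      (fun q : Edge 3 L × Fin 2 × Fin 2 × Bool => (fun z : ℂ => if q.2.2.2 then z.im else z.re)
        ((X q.1 * (fundamentalLatticeRep 2).ρ (γ 0 q.1)) q.2.1 q.2.2.1))) 0 :=
    hasDerivAt_comp_coords_prodFlow_two V X hXh hX0 hf 0
  have hvec : (fun q : Edge 3 L × Fin 2 × Fin 2 × Bool => (fun z : ℂ => if q.2.2.2 then z.im else z.re)
      ((X q.1 * (fundamentalLatticeRep 2).ρ (γ 0 q.1)) q.2.1 q.2.2.1)) =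
      ∑ n : Edge 3 L × NoiseIdx (fundamentalLatticeRep 2).N, D n • (fun q : Edge 3 L × Fin (fundamentalLatticeRep 2).N × Fin (fundamentalLatticeRep 2).N × Bool =>
        if n.1 = q.1 then (fun z : ℂ => if q.2.2.2 then z.im else z.re) (((Real.sqrt 2 : ℂ) • ((fundamentalLatticeRep 2).lieProj (noiseDir n.2) *
          (fundamentalLatticeRep 2).ρ (V q.1))) q.2.1 q.2.2.1) else 0) := by
    rw [hγ0]; exact coordVec_sum_smul_lieProj_two V D
  set Λ : (Edge 3 L × Fin (fundamentalLatticeRep 2).N × Fin (fundamentalLatticeRep 2).N × Bool → ℝ) →L[ℝ] ℝ := fderiv ℝ f (coords V) with hΛ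
  have hval : fderiv ℝ f (coords (γ 0)) (fun q : Edge 3 L × Fin 2 × Fin 2 × Bool => (fun z : ℂ => if q.2.2.2 then z.im else z.re)
      ((X q.1 * (fundamentalLatticeRep 2).ρ (γ 0 q.1)) q.2.1 q.2.2.1)) = G := by
    rw [hvec, hγ0]
    change Λ (∑ n : Edge 3 L × NoiseIdx (fundamentalLatticeRep 2).N, D n • (fun q : Edge 3 L × Fin (fundamentalLatticeRep 2).N × Fin (fundamentalLatticeRep 2).N × Bool =>
        if n.1 = q.1 then (fun z : ℂ => if q.2.2.2 then z.im else z.re) (((Real.sqrt 2 : ℂ) • ((fundamentalLatticeRep 2).lieProj (noiseDir n.2) *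
          (fundamentalLatticeRep 2).ρ (V q.1))) q.2.1 q.2.2.1) else 0)) = G
    rw [map_sum, hGdef]
    refine Finset.sum_congr rfl fun n _ => ?_
    rw [map_smul, smul_eq_mul, sq]
    rfl
  replace hder := hder.congr_deriv hval
  -- the Lipschitz bound along the flow
  have hC0 : 0 ≤ Lf * Real.sqrt (2 * G) := by positivity
  -- the flow stays `ρ_L`-close to `V` for `|s| < δ/(√(2G) + 1)`
  have hlipflow : ∀ᶠ s in 𝓝 (0 : ℝ), ‖f (coords (γ s)) - f (coords (γ 0))‖ ≤ Lf * Real.sqrt (2 * G) * ‖s - 0‖ := by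
    have hpos : 0 < δ / (Real.sqrt (2 * G) + 1) := by positivity
    rw [Metric.eventually_nhds_iff]
    refine ⟨δ / (Real.sqrt (2 * G) + 1), hpos, fun s hs => ?_⟩
    rw [Real.dist_eq, sub_zero] at hs
    rw [sub_zero, Real.norm_eq_abs, Real.norm_eq_abs, hγ0]
    have h2 : Real.sqrt (torusRiemannDistSq (fundamentalLatticeRep 2) V (γ s)) ≤ |s| * Real.sqrt (2 * G) := by
      calc Real.sqrt (torusRiemannDistSq (fundamentalLatticeRep 2) V (γ s))
          ≤ Real.sqrt (s ^ 2 * (2 * G)) := Real.sqrt_le_sqrt ((torusRiemannDistSq_prodFlow_le V X hXmem hXh hX0 s).trans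
              (mul_le_mul_of_nonneg_left hXnorm (sq_nonneg s)))
        _ = |s| * Real.sqrt (2 * G) := by rw [Real.sqrt_mul (sq_nonneg s), Real.sqrt_sq_eq_abs]
    have hclose : Real.sqrt (torusRiemannDistSq (fundamentalLatticeRep 2) V (γ s)) < δ := by
      have hsG : |s| * Real.sqrt (2 * G) ≤ |s| * (Real.sqrt (2 * G) + 1) := mul_le_mul_of_nonneg_left (by linarith) (abs_nonneg s)
      have hlt : |s| * (Real.sqrt (2 * G) + 1) < δ := by
        have := (lt_div_iff₀ (by positivity : (0:ℝ) < Real.sqrt (2 * G) + 1)).1 hs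
        linarith
      linarith
    have h1 := hlip (γ s) hclose
    calc |f (coords (γ s)) - f (coords V)| ≤ Lf * Real.sqrt (torusRiemannDistSq (fundamentalLatticeRep 2) V (γ s)) := h1
      _ ≤ Lf * (|s| * Real.sqrt (2 * G)) := mul_le_mul_of_nonneg_left h2 hLf
      _ = Lf * Real.sqrt (2 * G) * |s| := by ring
  have hGle : G ≤ Lf * Real.sqrt (2 * G) := by
    have h := hder.le_of_lip' hC0 hlipflow
    rw [Real.norm_eq_abs, abs_of_nonneg hG0] at h
    exact h
  -- `G ≤ L_f √(2G)` ⇒ `G ≤ 2 L_f²`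
  by_contra hcon
  push Not at hcon
  have hGpos : 0 < G := lt_of_le_of_lt (by positivity) hcon
  have hsq : G ^ 2 ≤ Lf ^ 2 * (2 * G) := by
    calc G ^ 2 ≤ (Lf * Real.sqrt (2 * G)) ^ 2 := pow_le_pow_left₀ hG0 hGle 2
      _ = Lf ^ 2 * (2 * G) := by rw [mul_pow, Real.sq_sqrt (by positivity)]
  nlinarith


end Local

end Summit.QuantumFields.YangMills.Theorems.ColdStartUniversality

end
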